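import Literature.NumberTheory.Automorphic.SupercuspidalProjectiveGL
import Literature.NumberTheory.Automorphic.ParabolicInductionSupercuspidalProofs
import Literature.NumberTheory.Automorphic.SupercuspFormUnipotentIntegral
import Literature.NumberTheory.Automorphic.MatrixCoefficientsProofs
import HarnessLib

/-!
# Test functions at a supercuspidal place: compactly supported supercusp forms `ξ` with
# `∫ ξ(g) ũ(π(g) u) dg ≠ 0`
(Gelbart, *Automorphic forms on adele groups* (1975), §10, p. 153: "`f_v(g_v) = d(π_v)
\overline{(π_v(g) u_v, u_v)}` … the matrix coefficients of `π_v(π'_v)` are compactly supported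
modulo `Z_v`"; Jacquet–Langlands, LNM 114 (1970), §16, p. 503, `ξ_v(g) = d(σ_v)
\overline{(σ_v(g) u_v, u_v)}`; Harish-Chandra, LNM 162 (1970), Part I §3)

Topic `NumberTheory/Automorphic`; theorems only (no definition, no named fact, no instance). In
the comparison of trace formulas proving the Jacquet–Langlands correspondence the factor of the
test function at a place `v` where `π_v` is supercuspidal is the (complex conjugate of a) matrix
coefficient of `π_v`. The tree's global objects (`L²(GL_n(K) ℝ_{>0} \ GL_n(𝔸_K))`, all central
characters at once; test functions in `C_c(GL_n(𝔸_K))`) require a factor that is *compactly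
supported on `GL_n(K_v)` itself*, not merely modulo the centre; cutting the coefficient off by a
function of the determinant achieves this without destroying the two properties that matter.
For a non-archimedean local field `F`, a smooth **supercuspidal** complex representation `π` of
`GL_n(F)` (`Representation.IsSupercuspidal`: smooth coefficients compactly supported modulo the
centre) and `0 ≠ u ∈ V`:

* `det_coe_unipotentOfBlock` — `det (1 + Y) = 1` for `Y ∈ 𝔫_k(F)`.
* `isCompact_preimage_unipotentOfBlock`, `hasCompactSupport_comp_unipotentOfBlock_local` — the
  unipotent slices `Y ↦ ξ(a (1 + Y) b)` of a compactly supported `ξ` are compactly supported on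
  `𝔫_k(F)`.
* `exists_isCompact_forall_mem_center_mul_det` — **the cut-off is compact**: for `C ⊆ GL_n(F)`
  compact and a uniformizer `ϖ`, the elements `g ∈ C · Z(GL_n(F))` with
  `|ϖ|^n < |det g| ≤ 1` lie in a compact set (writing `Z ⊆ GL_n(𝒪) · ⟨ϖ · 1⟩`,
  `center_subset_glInt_mul_zpowers`, the exponent of `ϖ · 1` is pinned to finitely many values
  by `|det g|`).
* `exists_supercuspTestFunction` — **there is `ξ ∈ C_c(GL_n(F))` with**
  (i) **`∫_{𝔫_k(F)} ξ(a (1 + Y) b) dY = 0` for all `0 < k < n`, all `a, b ∈ GL_n(F)` and every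
  additive Haar measure `dY`** (any Borel structure) — a supercusp form — **and**
  (ii) **`∫_{GL_n(F)} ξ(g) ũ(π(g) u) dμ(g) ≠ 0`** for a smooth linear form `ũ ∈ Ṽ`, `μ` any Haar
  measure on `GL_n(F)`. Namely `ξ(g) = \overline{ũ(π(g) u)} · 1_{|ϖ|^n < |det g| ≤ 1}` for a
  smooth `ũ` with `ũ(u) ≠ 0` (`IsSmooth.exists_mem_contragredient_apply_ne_zero_of_mem_fixedPoints`):
  (i) is `integral_matrixCoeff_unipotent_eq_zero` (`SupercuspFormUnipotentIntegral`) because the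
  cut-off is constant along `N_k` (`det (1 + Y) = 1`), and (ii) because the integrand of
  `∫ ξ ũ(π(·) u) = ∫ |ũ(π(g) u)|² 1_{…}(det g)` is continuous, non-negative and positive at `1`.
  Through `IntegratedOperatorSmoothVectors` (`π(ξ)(f u) = f(Σ_γ (∫_{γK} ξ) π(γ̃) u)` and
  `ũ(Σ_γ …) = ∫ ξ ũ(π(·) u)`), (ii) is the non-vanishing of `R(Φ)` on a constituent with local
  component `π` for `Φ = ξ ⊗ Φ^v`, and (i) feeds the cuspidal-image theorem
  (`UnipotentAveragesLocalPlace` / `SupercuspTypeCuspidalImage`).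

## References

* S. Gelbart, *Automorphic forms on adele groups*, Ann. of Math. Studies 83 (1975), §10, p. 153,
  Remark 9.23 [Gelbart1975].
* H. Jacquet, R. P. Langlands, *Automorphic forms on `GL(2)`*, LNM 114 (1970), §16, p. 503
  [JacquetLanglands1970].
* Harish-Chandra, *Harmonic analysis on reductive `p`-adic groups*, LNM 162 (1970), Part I §3
  [HarishChandra1970].
-/

noncomputable section

open MeasureTheory Measure Set Filter Topology ValuativeRel CompactlySupported
open scoped MatrixGroups Pointwise ComplexConjugate

namespace Literature.NumberTheory.Automorphic

/-! ### `det (1 + Y) = 1` and compact unipotent slices -/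

section Unipotent

variable {F : Type*} [Field F] {n k : ℕ}

/-- `det (1 + Y) = 1` for a block-nilpotent `Y` (`1 + Y` is upper unitriangular). [folklore] -/
theorem det_coe_unipotentOfBlock (Y : blockNilpotent n k F) :
    ((unipotentOfBlock n k F (Multiplicative.ofAdd Y) : GL (Fin n) F) : Matrix (Fin n) (Fin n) F).det = 1 := by
  rw [coe_unipotentOfBlock, toAdd_ofAdd]
  have hT : ((1 : Matrix (Fin n) (Fin n) F) + (Y : Matrix (Fin n) (Fin n) F)).BlockTriangular id := by
    intro i j hij
    have hij' : j < i := hij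
    rw [Matrix.add_apply, Matrix.one_apply_ne (ne_of_gt hij'),
      apply_eq_zero_of_mem_blockNilpotent Y.2 (fun h => ?_), add_zero]
    have h1 : (j : ℕ) < (i : ℕ) := hij'
    omega
  rw [Matrix.det_of_upperTriangular hT]
  refine Finset.prod_eq_one fun i _ => ?_
  rw [Matrix.add_apply, Matrix.one_apply_eq, apply_eq_zero_of_mem_blockNilpotent Y.2 (fun h => ?_),
    add_zero]
  omega

/-- `det (a (1 + Y) b) = det a · det b`. [folklore] -/
theorem det_coe_mul_unipotentOfBlock_mul (a b : GL (Fin n) F) (Y : blockNilpotent n k F) :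
    ((a * unipotentOfBlock n k F (Multiplicative.ofAdd Y) * b : GL (Fin n) F) :
      Matrix (Fin n) (Fin n) F).det =
      ((a : Matrix (Fin n) (Fin n) F).det * (b : Matrix (Fin n) (Fin n) F).det) := by
  rw [Units.val_mul, Units.val_mul, Matrix.det_mul, Matrix.det_mul, det_coe_unipotentOfBlock,
    mul_one]

variable [TopologicalSpace F] [IsTopologicalRing F] [T2Space F]

omit [IsTopologicalRing F] in
/-- `𝔫_k(F)` is closed in `M_n(F)` (finitely many closed conditions `X i j = 0`). [folklore] -/
theorem isClosed_coe_blockNilpotent_local :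
    IsClosed ((blockNilpotent n k F : AddSubgroup (Matrix (Fin n) (Fin n) F)) :
      Set (Matrix (Fin n) (Fin n) F)) := by
  have : ((blockNilpotent n k F : AddSubgroup (Matrix (Fin n) (Fin n) F)) :
      Set (Matrix (Fin n) (Fin n) F)) =
      ⋂ (i : Fin n), ⋂ (j : Fin n), {X | ¬ ((i : ℕ) < k ∧ k ≤ (j : ℕ)) → X i j = 0} := by
    ext X
    simp only [SetLike.mem_coe, Set.mem_iInter, Set.mem_setOf_eq]
    exact ⟨fun h i j hij => apply_eq_zero_of_mem_blockNilpotent h hij,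
      fun h i j hne => by_contra (fun hij => hne (h i j hij))⟩
  rw [this]
  refine isClosed_iInter fun i => isClosed_iInter fun j => ?_
  by_cases hij : (i : ℕ) < k ∧ k ≤ (j : ℕ)
  · simp [hij]
  · simp only [hij, not_false_eq_true, forall_const]
    exact isClosed_eq (continuous_id.matrix_elem i j) continuous_const

/-- **The unipotent points in a compact set form a compact set**: for `T ⊆ GL_n(F)` compact,
`{Y ∈ 𝔫_k(F) | 1 + Y ∈ T}` is compact (its image in `M_n(F)` under the closed embedding
`𝔫_k(F) ↪ M_n(F)` lies in the compact `(M ↦ 1 + M)⁻¹ (val T)`). [folklore] -/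
theorem isCompact_preimage_unipotentOfBlock {T : Set (GL (Fin n) F)} (hT : IsCompact T) :
    IsCompact {Y : blockNilpotent n k F | unipotentOfBlock n k F (Multiplicative.ofAdd Y) ∈ T} := by
  haveI : T2Space (Matrix (Fin n) (Fin n) F) := inferInstanceAs (T2Space (Fin n → Fin n → F))
  set Q : Set (Matrix (Fin n) (Fin n) F) :=
    (fun M => (1 : Matrix (Fin n) (Fin n) F) + M) ⁻¹' ((Units.val : GL (Fin n) F → _) '' T) with hQ
  have hQc : IsCompact Q := by
    have h1 : IsCompact ((Units.val : GL (Fin n) F → Matrix (Fin n) (Fin n) F) '' T) :=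
      hT.image Units.continuous_val
    exact (Homeomorph.addLeft (1 : Matrix (Fin n) (Fin n) F)).isCompact_preimage.2 h1
  have hemb : IsClosedEmbedding (Subtype.val : blockNilpotent n k F → Matrix (Fin n) (Fin n) F) :=
    isClosed_coe_blockNilpotent_local.isClosedEmbedding_subtypeVal
  have hPc : IsCompact ((Subtype.val : blockNilpotent n k F → Matrix (Fin n) (Fin n) F) ⁻¹' Q) :=
    hemb.isCompact_preimage hQc
  refine hPc.of_isClosed_subset ?_ fun Y hY => ?_
  · exact (hT.isClosed.preimage
      (Units.continuous_iff.2 ⟨continuous_const.add continuous_subtype_val,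
        continuous_const.sub continuous_subtype_val⟩))
  · rw [Set.mem_preimage, hQ, Set.mem_preimage]
    exact ⟨_, hY, rfl⟩

/-- **Unipotent slices of compactly supported functions are compactly supported**:
`Y ↦ ξ(a (1 + Y) b)` has compact support on `𝔫_k(F)` for `ξ` compactly supported on `GL_n(F)`.
[folklore] -/
theorem hasCompactSupport_comp_unipotentOfBlock_local {E : Type*} [Zero E] [TopologicalSpace E]
    {ξ : GL (Fin n) F → E} (hξ : HasCompactSupport ξ) (a b : GL (Fin n) F) :
    HasCompactSupport fun Y : blockNilpotent n k F =>
      ξ (a * unipotentOfBlock n k F (Multiplicative.ofAdd Y) * b) := by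
  haveI : T2Space (Matrix (Fin n) (Fin n) F) := inferInstanceAs (T2Space (Fin n → Fin n → F))
  have hTc : IsCompact ({a⁻¹} * tsupport ξ * {b⁻¹} : Set (GL (Fin n) F)) :=
    (isCompact_singleton.mul hξ.isCompact).mul isCompact_singleton
  refine HasCompactSupport.intro (isCompact_preimage_unipotentOfBlock hTc) fun Y hY => ?_
  have hnot : a * unipotentOfBlock n k F (Multiplicative.ofAdd Y) * b ∉ tsupport ξ := by
    intro hmem
    apply hY
    refine ⟨a⁻¹ * (a * unipotentOfBlock n k F (Multiplicative.ofAdd Y) * b), ?_, b⁻¹, rfl, by group⟩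
    exact Set.mul_mem_mul rfl hmem
  exact image_eq_zero_of_notMem_tsupport hnot

end Unipotent

/-! ### The determinant cut-off is compact on `C · Z(GL_n(F))` -/

section CutOff

variable {F : Type*} [Field F] [ValuativeRel F] [TopologicalSpace F] [IsNonarchimedeanLocalField F]
  {n : ℕ}

omit [ValuativeRel F] [TopologicalSpace F] [IsNonarchimedeanLocalField F] in
/-- `det (ϖ · 1) = ϖ^n`. [folklore] -/
theorem det_coe_scalar (u : Fˣ) :
    ((Matrix.GeneralLinearGroup.scalar (Fin n) u : GL (Fin n) F) : Matrix (Fin n) (Fin n) F).det =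
      (u : F) ^ n := by
  rw [Matrix.GeneralLinearGroup.coe_scalar, Matrix.scalar_apply, Matrix.det_diagonal,
    Finset.prod_const, Finset.card_univ, Fintype.card_fin]

/-- **The determinant cut-off on `C · Z` is compact.** Let `C ⊆ GL_n(F)` be compact, `0 < n`, and
`ϖ` a uniformizer. There is a compact `T ⊆ GL_n(F)` containing every `g ∈ C · Z(GL_n(F))` with
`|ϖ|^n < |det g| ≤ 1`. Proof: `Z ⊆ GL_n(𝒪) · ⟨ϖ · 1⟩` (`center_subset_glInt_mul_zpowers`), so
`g = c k (ϖ · 1)^a` with `|det g| = |det c| · |ϖ|^{a n}`; as `|det c|` is bounded above and below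
on `C`, the condition pins `a` to a finite interval, and `g ∈ ⋃_a (C · GL_n(𝒪)) (ϖ · 1)^a`.
[folklore] -/
theorem exists_isCompact_forall_mem_center_mul_det (hn : 0 < n) {C : Set (GL (Fin n) F)}
    (hC : IsCompact C) {ϖ : F} (hϖ : IsUniformizingElement ϖ) :
    ∃ T : Set (GL (Fin n) F), IsCompact T ∧ ∀ g : GL (Fin n) F,
      g ∈ C * (Subgroup.center (GL (Fin n) F) : Set (GL (Fin n) F)) →
      valuation F ϖ ^ n < valuation F (g : Matrix (Fin n) (Fin n) F).det →
      valuation F (g : Matrix (Fin n) (Fin n) F).det ≤ 1 → g ∈ T := by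
  have hϖ0 : ϖ ≠ 0 := hϖ.ne_zero
  have hv0 : valuation F ϖ ≠ 0 := (Valuation.ne_zero_iff _).2 hϖ0
  have hv1 : valuation F ϖ < 1 := hϖ.valuation_lt_one
  set s : GL (Fin n) F := Matrix.GeneralLinearGroup.scalar (Fin n) (Units.mk0 ϖ hϖ0) with hs
  have hdets : ∀ a : ℤ, valuation F (((s ^ a : GL (Fin n) F)) : Matrix (Fin n) (Fin n) F).det =
      (valuation F ϖ ^ n) ^ a := by
    intro a
    rw [hs, ← map_zpow, det_coe_scalar, Units.val_zpow_eq_zpow_val, Units.val_mk0, ← zpow_natCast,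
      ← zpow_mul, mul_comm, zpow_mul, map_zpow₀, zpow_natCast, map_pow]
  -- bounds for `|det c|`, `c ∈ C`, above and below
  have hdetc : Continuous fun g : GL (Fin n) F => (g : Matrix (Fin n) (Fin n) F).det :=
    Units.continuous_val.matrix_det
  have hdetci : Continuous fun g : GL (Fin n) F => ((g⁻¹ : GL (Fin n) F) : Matrix (Fin n) (Fin n) F).det :=
    Units.continuous_coe_inv.matrix_det
  obtain ⟨Bhi, hBhi⟩ := exists_forall_valuation_le_of_isCompact (hC.image hdetc)
  obtain ⟨Blo, hBlo⟩ := exists_forall_valuation_le_of_isCompact (hC.image hdetci)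
  -- the admissible exponents form a finite interval
  obtain ⟨N₁, hN₁⟩ := exists_forall_lt_zpow_neg hv0 hv1 Blo
  obtain ⟨d, hd⟩ := exists_pow_mul_le hv0 hv1 Bhi (pow_ne_zero n hv0)
  set T : Set (GL (Fin n) F) :=
    ⋃ a ∈ Finset.Icc (-(N₁ : ℤ)) d, (C * (glInt n F : Set (GL (Fin n) F))) * {s ^ a} with hT
  refine ⟨T, ?_, fun g hg hlo hhi => ?_⟩
  · refine (Finset.Icc (-(N₁ : ℤ)) d).finite_toSet.isCompact_biUnion fun a _ => ?_
    exact (hC.mul (isCompact_glInt n F)).mul isCompact_singleton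
  obtain ⟨c, hc, z, hz, rfl⟩ := Set.mem_mul.1 hg
  obtain ⟨kk, hk, y, hy, rfl⟩ := Set.mem_mul.1 (center_subset_glInt_mul_zpowers (n := n) hϖ hz)
  obtain ⟨a, rfl⟩ := Subgroup.mem_zpowers_iff.1 hy
  -- `|det g| = |det c| · |ϖ|^{a n}`
  have hdet : valuation F ((c * (kk * s ^ a) : GL (Fin n) F) : Matrix (Fin n) (Fin n) F).det =
      valuation F (c : Matrix (Fin n) (Fin n) F).det * (valuation F ϖ ^ n) ^ a := by
    rw [Units.val_mul, Units.val_mul, Matrix.det_mul, Matrix.det_mul, map_mul, map_mul,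
      valuation_det_eq_one_of_mem_glInt hk, one_mul, hdets]
  rw [hdet] at hlo hhi
  have hcBhi : valuation F (c : Matrix (Fin n) (Fin n) F).det ≤ Bhi := hBhi _ ⟨c, hc, rfl⟩
  have hcBlo : valuation F ((c⁻¹ : GL (Fin n) F) : Matrix (Fin n) (Fin n) F).det ≤ Blo :=
    hBlo _ ⟨c, hc, rfl⟩
  have hcne : valuation F (c : Matrix (Fin n) (Fin n) F).det ≠ 0 := by
    rw [Valuation.ne_zero_iff]
    exact (Matrix.isUnit_iff_isUnit_det _).1 c.isUnit |>.ne_zero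
  have hcinv : valuation F ((c⁻¹ : GL (Fin n) F) : Matrix (Fin n) (Fin n) F).det =
      (valuation F (c : Matrix (Fin n) (Fin n) F).det)⁻¹ := by
    rw [Matrix.coe_units_inv, Matrix.det_nonsing_inv, Ring.inverse_eq_inv', map_inv₀]
  -- lower bound on `a`
  have ha1 : -(N₁ : ℤ) ≤ a := by
    by_contra hlt
    push Not at hlt
    -- then `(|ϖ|^n)^a ≥ |ϖ|^{a} > Blo ≥ |det c|⁻¹`, contradicting `|det c| (|ϖ|^n)^a ≤ 1`
    have hNa : N₁ ≤ (-a).toNat := by omega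
    have h1 := hN₁ _ hNa
    have h2 : (valuation F ϖ) ^ (-((-a).toNat : ℤ)) ≤ (valuation F ϖ ^ n) ^ a := by
      have hneg : (-((-a).toNat : ℤ)) = a := by omega
      rw [hneg, ← zpow_natCast, ← zpow_mul]
      refine zpow_le_zpow_right_of_le_one₀ (zero_lt_iff.2 hv0) hv1.le ?_
      have : (n : ℤ) * a ≤ 1 * a := by
        refine Int.mul_le_mul_of_nonpos_right ?_ (by omega)
        exact_mod_cast hn
      simpa using this
    have h3 : Blo < (valuation F ϖ ^ n) ^ a := lt_of_lt_of_le h1 h2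
    have h4 : (valuation F (c : Matrix (Fin n) (Fin n) F).det)⁻¹ < (valuation F ϖ ^ n) ^ a :=
      lt_of_le_of_lt (hcinv ▸ hcBlo) h3
    have h5 : 1 < valuation F (c : Matrix (Fin n) (Fin n) F).det * (valuation F ϖ ^ n) ^ a := by
      have := mul_lt_mul_of_pos_left h4 (zero_lt_iff.2 hcne)
      rwa [mul_inv_cancel₀ hcne] at this
    exact absurd hhi (not_le.2 h5)
  -- upper bound on `a`
  have ha2 : a ≤ d := by
    by_contra hlt
    push Not at hlt
    -- then `(|ϖ|^n)^a ≤ |ϖ|^d`, so `|det c| (|ϖ|^n)^a ≤ Bhi |ϖ|^d ≤ |ϖ|^n`, contradiction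
    have h2 : (valuation F ϖ ^ n) ^ a ≤ valuation F ϖ ^ d := by
      rw [← zpow_natCast (valuation F ϖ) d, ← zpow_natCast, ← zpow_mul]
      refine zpow_le_zpow_right_of_le_one₀ (zero_lt_iff.2 hv0) hv1.le ?_
      have : (1 : ℤ) * (d : ℤ) ≤ (n : ℤ) * a := by
        have hn' : (1 : ℤ) ≤ n := by exact_mod_cast hn
        nlinarith
      simpa using this
    have h3 : valuation F (c : Matrix (Fin n) (Fin n) F).det * (valuation F ϖ ^ n) ^ a ≤
        valuation F ϖ ^ d * Bhi := by
      rw [mul_comm (valuation F ϖ ^ d)]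
      exact mul_le_mul' hcBhi h2
    exact absurd (lt_of_lt_of_le hlo (h3.trans hd)) (lt_irrefl _)
  -- hence `g ∈ T`
  refine Set.mem_iUnion₂.2 ⟨a, Finset.mem_Icc.2 ⟨ha1, ha2⟩, ?_⟩
  refine ⟨c * kk, Set.mul_mem_mul hc hk, s ^ a, rfl, ?_⟩
  simp only [mul_assoc, hs]

end CutOff

/-! ### Test functions at a supercuspidal place -/

section TestFunction

variable {F : Type*} [Field F] [ValuativeRel F] [TopologicalSpace F] [IsNonarchimedeanLocalField F]
  {n : ℕ} {V : Type*} [AddCommGroup V] [Module ℂ V] (π : Representation ℂ (GL (Fin n) F) V)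
  [MeasurableSpace (GL (Fin n) F)] [BorelSpace (GL (Fin n) F)]

/-- **Test functions at a supercuspidal place from a given smooth linear form.** Let `π` be a
smooth supercuspidal complex representation of `GL_n(F)` (`0 < n`), `u ∈ V`, `ũ ∈ Ṽ` a smooth
linear form with `ũ(u) ≠ 0` and `μ` a Haar measure on `GL_n(F)`. There is `ξ ∈ C_c(GL_n(F))` —
`ξ(g) = \overline{ũ(π(g) u)} · 1_{|ϖ|^n < |det g| ≤ 1}` — such that
(i) `∫_{𝔫_k(F)} ξ(a (1 + Y) b) dY = 0` for all `0 < k < n`, `a, b ∈ GL_n(F)` (a supercusp form), and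
(ii) `∫ ξ(g) ũ(π(g) u) dμ ≠ 0` (Gelbart (1975), p. 153; Jacquet–Langlands (1970), p. 503).
This version also records a compact open subgroup `U ≤ Stab(u)` with `|det| = 1` on `U` under
which `ξ` is right invariant (`ξ` is locally constant: the coefficient is right-`Stab(u)`-invariant
and the cut-off only sees `|det g|`), as needed to expand `ξ = Σ_t ξ(t) 1_{tU}` in the Hecke
algebra, and a compact open `U' ≤ Stab(ũ)` (`ũ ∘ π(k) = ũ` on `U'`) under which `ξ` is **left**
invariant (so that `ξ^*(g) = \overline{ξ(g⁻¹)}` is right-`U'`-invariant), and the pointwise facts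
`ξ(g) ũ(π(g) u) = |ũ(π(g) u)|² 1_{…}(det g) ≥ 0` (real) and `> 0` at `g = 1`. [cite: Gelbart1975, §10 p. 153] -/
theorem exists_supercuspTestFunction_of_mem_contragredient_left (hn : 0 < n) (hπ : π.IsSmooth)
    (hsc : π.IsSupercuspidal) {u : V} {ut : Module.Dual ℂ V} (hut : ut ∈ π.contragredient)
    (hutu : ut u ≠ 0) (μ : Measure (GL (Fin n) F)) [μ.IsHaarMeasure] :
    ∃ ξ : C_c(GL (Fin n) F, ℂ),
      (∀ k, 0 < k → k < n → ∀ [MeasurableSpace (blockNilpotent n k F)] [BorelSpace (blockNilpotent n k F)]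
        (α : Measure (blockNilpotent n k F)) [α.IsAddHaarMeasure] (a b : GL (Fin n) F),
        ∫ Y, ξ (a * unipotentOfBlock n k F (Multiplicative.ofAdd Y) * b) ∂α = 0) ∧
      ∫ g, ξ g * ut (π g u) ∂μ ≠ 0 ∧
      (∃ U : Subgroup (GL (Fin n) F), IsOpen (U : Set (GL (Fin n) F)) ∧
        IsCompact (U : Set (GL (Fin n) F)) ∧ (∀ k ∈ U, π k u = u) ∧
        ∀ (g : GL (Fin n) F), ∀ k ∈ U, ξ (g * k) = ξ g) ∧
      (∃ U' : Subgroup (GL (Fin n) F), IsOpen (U' : Set (GL (Fin n) F)) ∧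
        IsCompact (U' : Set (GL (Fin n) F)) ∧ (∀ k ∈ U', ∀ x : V, ut (π k x) = ut x) ∧
        ∀ (g : GL (Fin n) F), ∀ k ∈ U', ξ (k * g) = ξ g) ∧
      (∀ g, 0 ≤ (ξ g * ut (π g u)).re ∧ (ξ g * ut (π g u)).im = 0) ∧
        0 < (ξ 1 * ut (π 1 u)).re := by
  classical
  haveI : IsTopologicalRing F := inferInstance
  haveI := (GaloisRepresentations.IsNonarchimedeanLocalField.isLocalField F).toT2Space
  haveI : T2Space (Matrix (Fin n) (Fin n) F) := inferInstanceAs (T2Space (Fin n → Fin n → F))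
  -- the level `GL_n(𝒪) ∩ Stab(u)`
  set K₀ : Subgroup (GL (Fin n) F) := glInt n F ⊓ π.stabilizerSubgroup u with hK₀
  have hK₀o : IsOpen (K₀ : Set (GL (Fin n) F)) := (isOpen_glInt n F).inter (hπ u)
  have hK₀c : IsCompact (K₀ : Set (GL (Fin n) F)) :=
    (isCompact_glInt n F).of_isClosed_subset (Subgroup.isClosed_of_isOpen _ hK₀o) fun g hg => hg.1
  -- the coefficient, its support modulo the centre, a uniformizer and the cut-off
  set c : GL (Fin n) F → ℂ := fun g => ut (π g u) with hc
  have hcc : Continuous c := π.continuous_matrixCoeff ut (hπ u)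
  obtain ⟨C, hC, hsupp⟩ := hsc ut hut u
  obtain ⟨ϖ, hϖ⟩ := exists_isUniformizingElement (F := F)
  have hv0 : valuation F ϖ ≠ 0 := (Valuation.ne_zero_iff _).2 hϖ.ne_zero
  have hv1 : valuation F ϖ < 1 := hϖ.valuation_lt_one
  set D : Set F := {x | valuation F ϖ ^ n < valuation F x ∧ valuation F x ≤ 1} with hD
  set χ : GL (Fin n) F → ℂ := fun g => if (g : Matrix (Fin n) (Fin n) F).det ∈ D then 1 else 0 with hχ
  have hDcl : IsClopen D := by
    have h1 : IsClopen {x : F | valuation F x ≤ 1} :=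
      ⟨isClosed_setOf_valuation_le 1, DeltaCharBorel.isOpen_setOf_valuation_le one_ne_zero⟩
    have h2 : IsClopen {x : F | valuation F x ≤ valuation F ϖ ^ n} :=
      ⟨isClosed_setOf_valuation_le _, DeltaCharBorel.isOpen_setOf_valuation_le (pow_ne_zero n hv0)⟩
    have hD' : D = {x : F | valuation F x ≤ valuation F ϖ ^ n}ᶜ ∩ {x : F | valuation F x ≤ 1} := by
      ext x; simp [hD, not_le]
    rw [hD']
    exact h2.compl.inter h1
  have hdetc : Continuous fun g : GL (Fin n) F => (g : Matrix (Fin n) (Fin n) F).det :=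
    Units.continuous_val.matrix_det
  have hχc : Continuous χ := by
    refine (IsLocallyConstant.iff_exists_open χ).2 (fun g => ?_) |>.continuous
    by_cases hg : (g : Matrix (Fin n) (Fin n) F).det ∈ D
    · refine ⟨_, hDcl.isOpen.preimage hdetc, hg, fun g' hg' => ?_⟩
      simp only [hχ, if_pos hg, if_pos (show (g' : Matrix (Fin n) (Fin n) F).det ∈ D from hg')]
    · refine ⟨_, hDcl.compl.isOpen.preimage hdetc, hg, fun g' hg' => ?_⟩
      simp only [hχ, if_neg hg, if_neg (show (g' : Matrix (Fin n) (Fin n) F).det ∉ D from hg')]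
  -- the test function
  set ξ : GL (Fin n) F → ℂ := fun g => conj (c g) * χ g with hξ
  have hξc : Continuous ξ := (Complex.continuous_conj.comp hcc).mul hχc
  obtain ⟨T, hT, hTmem⟩ := exists_isCompact_forall_mem_center_mul_det hn hC hϖ
  have hξs : HasCompactSupport ξ := by
    refine HasCompactSupport.intro hT fun g hg => ?_
    by_contra hne
    have hcg : c g ≠ 0 := by
      intro h0; exact hne (by simp only [hξ, h0, map_zero, zero_mul])
    have hχg : (g : Matrix (Fin n) (Fin n) F).det ∈ D := by
      by_contra h0; exact hne (by simp only [hξ, hχ, if_neg h0, mul_zero])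
    exact hg (hTmem g (hsupp (Function.mem_support.2 hcg)) hχg.1 hχg.2)
  -- the level: `U = GL_n(𝒪) ∩ Stab(u) ∩ {|det| = 1}`, under which `ξ` is right invariant
  set D₁ : Subgroup (GL (Fin n) F) :=
    { carrier := {g : GL (Fin n) F | valuation F ((g : Matrix (Fin n) (Fin n) F).det) = 1}
      mul_mem' := fun {a b} ha hb => by
        simp only [Set.mem_setOf_eq, Units.val_mul, Matrix.det_mul, map_mul] at ha hb ⊢
        rw [ha, hb, one_mul]
      one_mem' := by
        simp only [Set.mem_setOf_eq, Units.val_one, Matrix.det_one, map_one]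
      inv_mem' := fun {a} ha => by
        simp only [Set.mem_setOf_eq] at ha ⊢
        have h := congrArg (fun M : Matrix (Fin n) (Fin n) F => valuation F M.det) a.inv_mul
        simp only [Matrix.det_mul, map_mul, Matrix.det_one, map_one, ha, mul_one] at h
        exact h } with hD₁
  have hD₁o : IsOpen (D₁ : Set (GL (Fin n) F)) := by
    have hdetic : Continuous fun g : GL (Fin n) F => ((g⁻¹ : GL (Fin n) F) : Matrix (Fin n) (Fin n) F).det :=
      hdetc.comp continuous_inv
    have heq : (D₁ : Set (GL (Fin n) F)) =
        {g : GL (Fin n) F | valuation F ((g : Matrix (Fin n) (Fin n) F).det) ≤ 1} ∩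
          {g : GL (Fin n) F | valuation F (((g⁻¹ : GL (Fin n) F) : Matrix (Fin n) (Fin n) F).det) ≤ 1} := by
      ext g
      simp only [SetLike.mem_coe, Set.mem_inter_iff, Set.mem_setOf_eq]
      have hprod : valuation F (((g⁻¹ : GL (Fin n) F) : Matrix (Fin n) (Fin n) F).det) *
          valuation F ((g : Matrix (Fin n) (Fin n) F).det) = 1 := by
        have h := congrArg (fun M : Matrix (Fin n) (Fin n) F => valuation F M.det) g.inv_mul
        simpa only [Matrix.det_mul, map_mul, Matrix.det_one, map_one] using h
      constructor
      · intro hg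
        change valuation F ((g : Matrix (Fin n) (Fin n) F).det) = 1 at hg
        rw [hg, mul_one] at hprod
        exact ⟨hg.le, hprod.le⟩
      · rintro ⟨h1, h2⟩
        change valuation F ((g : Matrix (Fin n) (Fin n) F).det) = 1
        refine le_antisymm h1 ?_
        calc (1 : ValueGroupWithZero F)
            = valuation F (((g⁻¹ : GL (Fin n) F) : Matrix (Fin n) (Fin n) F).det) *
                valuation F ((g : Matrix (Fin n) (Fin n) F).det) := hprod.symm
          _ ≤ 1 * valuation F ((g : Matrix (Fin n) (Fin n) F).det) :=
              mul_le_mul_left h2 _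
          _ = valuation F ((g : Matrix (Fin n) (Fin n) F).det) := one_mul _
    rw [heq]
    exact ((DeltaCharBorel.isOpen_setOf_valuation_le one_ne_zero).preimage hdetc).inter
      ((DeltaCharBorel.isOpen_setOf_valuation_le one_ne_zero).preimage hdetic)
  set U : Subgroup (GL (Fin n) F) := K₀ ⊓ D₁ with hU
  have hUo : IsOpen (U : Set (GL (Fin n) F)) := hK₀o.inter hD₁o
  have hUc : IsCompact (U : Set (GL (Fin n) F)) :=
    hK₀c.of_isClosed_subset (Subgroup.isClosed_of_isOpen _ hUo) fun g hg => hg.1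
  have hUfix : ∀ k ∈ U, π k u = u := fun k hk => (π.mem_stabilizerSubgroup u k).1 hk.1.2
  have hξU : ∀ (g : GL (Fin n) F), ∀ k ∈ U, ξ (g * k) = ξ g := by
    intro g k hk
    have hck : c (g * k) = c g := by
      simp only [hc, map_mul, Module.End.mul_apply, hUfix k hk]
    have hvk : valuation F ((k : Matrix (Fin n) (Fin n) F).det) = 1 := hk.2
    have hχk : χ (g * k) = χ g := by
      simp only [hχ, Units.val_mul, Matrix.det_mul, hD, Set.mem_setOf_eq, map_mul, hvk, mul_one]
    simp only [hξ, hck, hχk]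
  -- the left level: `U' = GL_n(𝒪) ∩ Stab(ũ) ∩ {|det| = 1}`
  set S₀ : Subgroup (GL (Fin n) F) := π.dual.stabilizerSubgroup ut with hS₀
  have hS₀o : IsOpen (S₀ : Set (GL (Fin n) F)) := hut
  have hS₀fix : ∀ k ∈ S₀, ∀ x : V, ut (π k x) = ut x := by
    intro k hk x
    have h := (π.dual.mem_stabilizerSubgroup ut k⁻¹).1 (S₀.inv_mem hk)
    rw [Representation.dual_apply, inv_inv] at h
    have h' := congrArg (fun f : Module.Dual ℂ V => f x) h
    simpa only [Module.Dual.transpose_apply, LinearMap.comp_apply] using h'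
  set U' : Subgroup (GL (Fin n) F) := glInt n F ⊓ S₀ ⊓ D₁ with hU'
  have hU'o : IsOpen (U' : Set (GL (Fin n) F)) := ((isOpen_glInt n F).inter hS₀o).inter hD₁o
  have hU'c : IsCompact (U' : Set (GL (Fin n) F)) :=
    (isCompact_glInt n F).of_isClosed_subset (Subgroup.isClosed_of_isOpen _ hU'o) fun g hg => hg.1.1
  have hU'fix : ∀ k ∈ U', ∀ x : V, ut (π k x) = ut x := fun k hk x => hS₀fix k hk.1.2 x
  have hξU' : ∀ (g : GL (Fin n) F), ∀ k ∈ U', ξ (k * g) = ξ g := by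
    intro g k hk
    have hck : c (k * g) = c g := by
      simp only [hc, map_mul, Module.End.mul_apply, hU'fix k hk]
    have hvk : valuation F ((k : Matrix (Fin n) (Fin n) F).det) = 1 := hk.2
    have hχk : χ (k * g) = χ g := by
      simp only [hχ, Units.val_mul, Matrix.det_mul, hD, Set.mem_setOf_eq, map_mul, hvk, one_mul]
    simp only [hξ, hck, hχk]
  -- pointwise: `ξ(g) ũ(π(g) u) = |ũ(π(g) u)|² 1_D(det g)` is real, `≥ 0`, and `> 0` at `g = 1`
  have hpt : ∀ g, ξ g * ut (π g u) =
      (((‖c g‖ ^ 2 * (if (g : Matrix (Fin n) (Fin n) F).det ∈ D then 1 else 0) : ℝ)) : ℂ) := by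
    intro g
    change conj (c g) * χ g * c g = _
    rw [mul_right_comm, Complex.conj_mul', Complex.ofReal_mul, Complex.ofReal_pow]
    congr 1
    simp only [hχ]
    split_ifs <;> simp
  have hreal : ∀ g, 0 ≤ (ξ g * ut (π g u)).re ∧ (ξ g * ut (π g u)).im = 0 := by
    intro g
    rw [hpt g, Complex.ofReal_re, Complex.ofReal_im]
    exact ⟨mul_nonneg (sq_nonneg _) (by split_ifs <;> norm_num), rfl⟩
  have hone : 0 < (ξ 1 * ut (π 1 u)).re := by
    rw [hpt 1, Complex.ofReal_re]
    have hdet1 : ((1 : GL (Fin n) F) : Matrix (Fin n) (Fin n) F).det ∈ D := by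
      refine ⟨?_, ?_⟩
      · rw [Units.val_one, Matrix.det_one, map_one]
        exact pow_lt_one₀ zero_le hv1 hn.ne'
      · rw [Units.val_one, Matrix.det_one, map_one]
    have hc1 : c 1 ≠ 0 := by
      simp only [hc, map_one, Module.End.one_apply]
      exact hutu
    rw [if_pos hdet1, mul_one]
    exact pow_pos (norm_pos_iff.2 hc1) 2
  refine ⟨⟨⟨ξ, hξc⟩, hξs⟩, fun k hk hkn _ _ α _ a b => ?_, ?_, ⟨U, hUo, hUc, hUfix, hξU⟩,
    ⟨U', hU'o, hU'c, hU'fix, hξU'⟩, hreal, hone⟩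
  · -- (i) the unipotent averages vanish
    change ∫ Y, ξ (a * unipotentOfBlock n k F (Multiplicative.ofAdd Y) * b) ∂α = 0
    have hconst : ∀ Y : blockNilpotent n k F,
        χ (a * unipotentOfBlock n k F (Multiplicative.ofAdd Y) * b) = χ (a * b) := by
      intro Y
      change (if ((a * unipotentOfBlock n k F (Multiplicative.ofAdd Y) * b : GL (Fin n) F) :
          Matrix (Fin n) (Fin n) F).det ∈ D then (1 : ℂ) else 0) =
        if ((a * b : GL (Fin n) F) : Matrix (Fin n) (Fin n) F).det ∈ D then (1 : ℂ) else 0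
      rw [det_coe_mul_unipotentOfBlock_mul, Units.val_mul, Matrix.det_mul]
    have h1 : (fun Y : blockNilpotent n k F => ξ (a * unipotentOfBlock n k F (Multiplicative.ofAdd Y) * b)) =
        fun Y => conj (c (a * unipotentOfBlock n k F (Multiplicative.ofAdd Y) * b)) * χ (a * b) := by
      funext Y
      simp only [hξ, hconst]
    rw [h1, integral_mul_const]
    by_cases h0 : χ (a * b) = 0
    · rw [h0, mul_zero]
    -- the coefficient slice is integrable, being `conj` of the (compactly supported) slice of `ξ`
    -- divided by the constant `χ (a b)`
    have hξsl : Integrable (fun Y : blockNilpotent n k F =>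
        ξ (a * unipotentOfBlock n k F (Multiplicative.ofAdd Y) * b)) α :=
      (hξc.comp ((continuous_const.mul (Units.continuous_iff.2 ⟨continuous_const.add
        continuous_subtype_val, continuous_const.sub continuous_subtype_val⟩)).mul
        continuous_const)).integrable_of_hasCompactSupport
        (hasCompactSupport_comp_unipotentOfBlock_local hξs a b)
    have hcsl : Integrable (fun Y : blockNilpotent n k F =>
        c (a * unipotentOfBlock n k F (Multiplicative.ofAdd Y) * b)) α := by
      have h2 : (fun Y : blockNilpotent n k F => c (a * unipotentOfBlock n k F (Multiplicative.ofAdd Y) * b)) =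
          fun Y => conj (ξ (a * unipotentOfBlock n k F (Multiplicative.ofAdd Y) * b) * (χ (a * b))⁻¹) := by
        funext Y
        rw [show ξ (a * unipotentOfBlock n k F (Multiplicative.ofAdd Y) * b) =
            conj (c (a * unipotentOfBlock n k F (Multiplicative.ofAdd Y) * b)) *
              χ (a * unipotentOfBlock n k F (Multiplicative.ofAdd Y) * b) from rfl, hconst Y,
          mul_inv_cancel_right₀ h0, Complex.conj_conj]
      rw [h2]
      refine (Complex.continuous_conj.comp ((hξc.comp ((continuous_const.mul
        (Units.continuous_iff.2 ⟨continuous_const.add continuous_subtype_val,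
          continuous_const.sub continuous_subtype_val⟩)).mul continuous_const)).mul
        continuous_const)).integrable_of_hasCompactSupport ?_
      exact ((hasCompactSupport_comp_unipotentOfBlock_local hξs a b).mul_right).comp_left
        (map_zero _)
    rw [integral_conj]
    have h3 : ∫ Y : blockNilpotent n k F, c (a * unipotentOfBlock n k F (Multiplicative.ofAdd Y) * b) ∂α = 0 :=
      integral_matrixCoeff_unipotent_eq_zero π hπ hsc hk hkn α ut u a b hcsl
    rw [h3, map_zero, zero_mul]
  · -- (ii) `∫ ξ(g) ũ(π(g) u) dμ = ∫ |ũ(π(g) u)|² 1_D(det g) dμ > 0`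
    set r : GL (Fin n) F → ℝ := fun g =>
      ‖c g‖ ^ 2 * (if (g : Matrix (Fin n) (Fin n) F).det ∈ D then 1 else 0) with hr
    have hr_eq : (fun g : GL (Fin n) F => ξ g * ut (π g u)) = fun g => ((r g : ℝ) : ℂ) := by
      funext g
      change conj (c g) * χ g * c g = ((‖c g‖ ^ 2 * (if (g : Matrix (Fin n) (Fin n) F).det ∈ D then 1 else 0) : ℝ) : ℂ)
      rw [mul_right_comm, Complex.conj_mul', Complex.ofReal_mul, Complex.ofReal_pow]
      congr 1
      simp only [hχ]
      split_ifs <;> simp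
    change ∫ g, (fun g : GL (Fin n) F => ξ g * ut (π g u)) g ∂μ ≠ 0
    rw [hr_eq, integral_complex_ofReal, Complex.ofReal_ne_zero]
    have hχr : Continuous fun g : GL (Fin n) F =>
        (if (g : Matrix (Fin n) (Fin n) F).det ∈ D then (1 : ℝ) else 0) := by
      have : (fun g : GL (Fin n) F => (if (g : Matrix (Fin n) (Fin n) F).det ∈ D then (1 : ℝ) else 0)) =
          fun g => (χ g).re := by
        funext g
        simp only [hχ]
        split_ifs <;> simp
      rw [this]
      exact Complex.continuous_re.comp hχc
    have hrc : Continuous r := (hcc.norm.pow 2).mul hχr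
    have hrs : HasCompactSupport r := by
      refine HasCompactSupport.intro hT fun g hg => ?_
      by_contra hne
      have hcg : c g ≠ 0 := by
        intro h0
        exact hne (by simp only [hr, h0, norm_zero, ne_eq, OfNat.ofNat_ne_zero, not_false_eq_true,
          zero_pow, zero_mul])
      have hχg : (g : Matrix (Fin n) (Fin n) F).det ∈ D := by
        by_contra h0
        exact hne (by simp only [hr, if_neg h0, mul_zero])
      exact hg (hTmem g (hsupp (Function.mem_support.2 hcg)) hχg.1 hχg.2)
    have hr0 : 0 ≤ r := fun g => mul_nonneg (pow_nonneg (norm_nonneg _) 2)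
      (by split_ifs <;> norm_num)
    have hr1 : r 1 ≠ 0 := by
      have hdet1 : ((1 : GL (Fin n) F) : Matrix (Fin n) (Fin n) F).det ∈ D := by
        refine ⟨?_, ?_⟩
        · rw [Units.val_one, Matrix.det_one, map_one]
          exact pow_lt_one₀ zero_le hv1 hn.ne'
        · rw [Units.val_one, Matrix.det_one, map_one]
      have hc1 : c 1 ≠ 0 := by
        simp only [hc, map_one, Module.End.one_apply]
        exact hutu
      simp only [hr, if_pos hdet1, mul_one, ne_eq, pow_eq_zero_iff, OfNat.ofNat_ne_zero,
        not_false_eq_true, norm_eq_zero]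
      exact hc1
    exact (hrc.integral_pos_of_hasCompactSupport_nonneg_nonzero hrs hr0 hr1).ne'

/-- **Test functions at a supercuspidal place from a given smooth linear form** (right level only;
`exists_supercuspTestFunction_of_mem_contragredient_left` without the left level).
[cite: Gelbart1975, §10 p. 153] -/
theorem exists_supercuspTestFunction_of_mem_contragredient (hn : 0 < n) (hπ : π.IsSmooth)
    (hsc : π.IsSupercuspidal) {u : V} {ut : Module.Dual ℂ V} (hut : ut ∈ π.contragredient)
    (hutu : ut u ≠ 0) (μ : Measure (GL (Fin n) F)) [μ.IsHaarMeasure] :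
    ∃ ξ : C_c(GL (Fin n) F, ℂ),
      (∀ k, 0 < k → k < n → ∀ [MeasurableSpace (blockNilpotent n k F)] [BorelSpace (blockNilpotent n k F)]
        (α : Measure (blockNilpotent n k F)) [α.IsAddHaarMeasure] (a b : GL (Fin n) F),
        ∫ Y, ξ (a * unipotentOfBlock n k F (Multiplicative.ofAdd Y) * b) ∂α = 0) ∧
      ∫ g, ξ g * ut (π g u) ∂μ ≠ 0 ∧
      ∃ U : Subgroup (GL (Fin n) F), IsOpen (U : Set (GL (Fin n) F)) ∧
        IsCompact (U : Set (GL (Fin n) F)) ∧ (∀ k ∈ U, π k u = u) ∧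
        ∀ (g : GL (Fin n) F), ∀ k ∈ U, ξ (g * k) = ξ g := by
  obtain ⟨ξ, h1, h2, h3, -, -, -⟩ :=
    exists_supercuspTestFunction_of_mem_contragredient_left π hn hπ hsc hut hutu μ
  exact ⟨ξ, h1, h2, h3⟩

/-- **Test functions at a supercuspidal place, with a level.** Let `π` be a smooth supercuspidal
complex representation of `GL_n(F)` (`0 < n`), `u ∈ V` non-zero and `μ` a Haar measure on
`GL_n(F)`. There are a smooth linear form `ũ ∈ Ṽ` and `ξ ∈ C_c(GL_n(F))` —
`ξ(g) = \overline{ũ(π(g) u)} · 1_{|ϖ|^n < |det g| ≤ 1}` — such that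
(i) `∫_{𝔫_k(F)} ξ(a (1 + Y) b) dY = 0` for all `0 < k < n`, `a, b ∈ GL_n(F)` (a supercusp form), and
(ii) `∫ ξ(g) ũ(π(g) u) dμ ≠ 0` (Gelbart (1975), p. 153; Jacquet–Langlands (1970), p. 503),
together with a compact open subgroup `U ≤ Stab(u)` with `|det| = 1` on `U` under which `ξ` is right
invariant. The smooth form `ũ` with `ũ(u) ≠ 0` comes from
`exists_mem_contragredient_apply_ne_zero_of_mem_fixedPoints`, the rest is
`exists_supercuspTestFunction_of_mem_contragredient`. [cite: Gelbart1975, §10 p. 153] -/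
theorem exists_supercuspTestFunction_invariant (hn : 0 < n) (hπ : π.IsSmooth)
    (hsc : π.IsSupercuspidal) {u : V} (hu : u ≠ 0) (μ : Measure (GL (Fin n) F)) [μ.IsHaarMeasure] :
    ∃ ut ∈ π.contragredient, ∃ ξ : C_c(GL (Fin n) F, ℂ),
      (∀ k, 0 < k → k < n → ∀ [MeasurableSpace (blockNilpotent n k F)] [BorelSpace (blockNilpotent n k F)]
        (α : Measure (blockNilpotent n k F)) [α.IsAddHaarMeasure] (a b : GL (Fin n) F),
        ∫ Y, ξ (a * unipotentOfBlock n k F (Multiplicative.ofAdd Y) * b) ∂α = 0) ∧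
      ∫ g, ξ g * ut (π g u) ∂μ ≠ 0 ∧
      ∃ U : Subgroup (GL (Fin n) F), IsOpen (U : Set (GL (Fin n) F)) ∧
        IsCompact (U : Set (GL (Fin n) F)) ∧ (∀ k ∈ U, π k u = u) ∧
        ∀ (g : GL (Fin n) F), ∀ k ∈ U, ξ (g * k) = ξ g := by
  -- a smooth linear form with `ũ(u) ≠ 0`
  set K₀ : Subgroup (GL (Fin n) F) := glInt n F ⊓ π.stabilizerSubgroup u with hK₀
  have hK₀o : IsOpen (K₀ : Set (GL (Fin n) F)) := (isOpen_glInt n F).inter (hπ u)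
  have hK₀c : IsCompact (K₀ : Set (GL (Fin n) F)) :=
    (isCompact_glInt n F).of_isClosed_subset (Subgroup.isClosed_of_isOpen _ hK₀o) fun g hg => hg.1
  have huK₀ : u ∈ π.fixedPoints K₀ := (π.mem_fixedPoints K₀ u).2 fun g hg =>
    (π.mem_stabilizerSubgroup u g).1 hg.2
  obtain ⟨ut, hut, -, hutu⟩ :=
    hπ.exists_mem_contragredient_apply_ne_zero_of_mem_fixedPoints hK₀o hK₀c huK₀ hu
  exact ⟨ut, hut, exists_supercuspTestFunction_of_mem_contragredient π hn hπ hsc hut hutu μ⟩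

/-- **Test functions at a supercuspidal place.** Let `π` be a smooth supercuspidal complex
representation of `GL_n(F)` (`0 < n`), `u ∈ V` non-zero and `μ` a Haar measure on `GL_n(F)`.
There are a smooth linear form `ũ ∈ Ṽ` and `ξ ∈ C_c(GL_n(F))` —
`ξ(g) = \overline{ũ(π(g) u)} · 1_{|ϖ|^n < |det g| ≤ 1}` — such that
(i) `∫_{𝔫_k(F)} ξ(a (1 + Y) b) dY = 0` for all `0 < k < n`, `a, b ∈ GL_n(F)`, every Borel structure
and additive Haar measure on `𝔫_k(F)` (a supercusp form: the cut-off is constant along `N_k` since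
`det (1 + Y) = 1`, and `integral_matrixCoeff_unipotent_eq_zero` applies to the coefficient), and
(ii) `∫ ξ(g) ũ(π(g) u) dμ ≠ 0` (the integrand is `|ũ(π(g) u)|²` times the cut-off: continuous,
`≥ 0`, positive at `g = 1`). Gelbart (1975), p. 153 and Jacquet–Langlands (1970), p. 503 take
`ξ_v = d(π_v) \overline{⟨π_v(·) u_v, u_v⟩}` (compactly supported modulo `Z_v`, central character
fixed); the determinant cut-off adapts this to test functions compactly supported on the group.
(`exists_supercuspTestFunction_invariant` without the level.) [cite: Gelbart1975, §10 p. 153] -/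
theorem exists_supercuspTestFunction (hn : 0 < n) (hπ : π.IsSmooth) (hsc : π.IsSupercuspidal)
    {u : V} (hu : u ≠ 0) (μ : Measure (GL (Fin n) F)) [μ.IsHaarMeasure] :
    ∃ ut ∈ π.contragredient, ∃ ξ : C_c(GL (Fin n) F, ℂ),
      (∀ k, 0 < k → k < n → ∀ [MeasurableSpace (blockNilpotent n k F)] [BorelSpace (blockNilpotent n k F)]
        (α : Measure (blockNilpotent n k F)) [α.IsAddHaarMeasure] (a b : GL (Fin n) F),
        ∫ Y, ξ (a * unipotentOfBlock n k F (Multiplicative.ofAdd Y) * b) ∂α = 0) ∧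
      ∫ g, ξ g * ut (π g u) ∂μ ≠ 0 := by
  obtain ⟨ut, hut, ξ, h1, h2, -⟩ := exists_supercuspTestFunction_invariant π hn hπ hsc hu μ
  exact ⟨ut, hut, ξ, h1, h2⟩

end TestFunction

end Literature.NumberTheory.Automorphic
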